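import Mathlib
import Summits.Ventures.PercRepro2.Defs
import Summits.Ventures.PercRepro2.Graph
import Summits.Ventures.PercRepro2.NestedMaskBHK
import Summits.Ventures.PercRepro2.ThreeCopyCore

/-!
# The pairwise-disagreement form of the three-copy core (blind cell PercRepro2, mine-1 g28;
`proofs/MINE1-J1.md` §30 addendum 1 (iii) and §39)

The level core of the 2′CDC kernel `(F₁^A − F₁^B)(F₂^A − F₂^C) 1_{Q^A} 1_{Q^B} 1_{Q^C}` is invariant
under exchanging the two plain copies `B` and `C` — the level `lev x y z` of a triple is
(`lev_swap`, `core_swap`) — so it can be rewritten through the pairwise two-copy disagreement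
kernels `D_{XY} = (F₁^X − F₁^Y)(F₂^X − F₂^Y)`:

  `2 · core(cdc) = 2 · core(mixed) − core(plain)`   (`two_mul_core_cdcKernel`),

`mixed = 1_{QQQ} · D_{AB}` (the masked copy against a plain copy), `plain = 1_{QQQ} · D_{BC}` (plain
against plain).  So (3CORE) — `0 ≤ core(cdc)` for every level — says exactly that the MIXED
disagreement dominates HALF the plain–plain disagreement under the triple avoidance (the identity
was census-checked on 3,840 levels in §30 add. 1 (iii); here it is a theorem).

Weighted reading (`triForm_mixedKernel`, `triForm_plainKernel`, `two_mul_triForm_cdcKernel`): with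
`D(P^m, P) = P^m(Q,B,O) P(Q) − P^m(Q,B) P(Q,O) − P^m(Q,O) P(Q,B) + P^m(Q) P(Q,B,O)` the mixed
disagreement form and `K = P(Q) P(Q,B,O) − P(Q,B) P(Q,O)` the BHK slack of the plain graph,

  `2 · T = 2 · P(Q) · D(P^m, P) − 2 · P^m(Q) · K`,   i.e.   `T = P(Q) · D(P^m, P) − P^m(Q) · K`,

so (CCT-W) ⟺ `D(P^m, P) ≥ (P^m(Q) / P(Q)) · K`: the mixed covariance `Cov₀₁ = D(P^m,P)/(P(Q)P^m(Q))`
is at least the plain covariance `Cov₀ = K / P(Q)²`.  Identities only; nothing about the sign of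
`core(cdc)` is proved here.
-/

namespace Summit.Ventures.PercRepro2

namespace ThreeCopy

/-! ## The exchange symmetry of the two plain copies -/

section Symmetry

variable {E : Type*} [Fintype E] [DecidableEq E] {R : Type*} [CommRing R]

omit [Fintype E] [DecidableEq E] in
/-- The level of a triple is symmetric in the last two copies. -/
lemma lev_swap (x y z : Config E) : lev x z y = lev x y z := by
  funext e
  apply Fin.ext
  show (x e).toNat + (z e).toNat + (y e).toNat = (x e).toNat + (y e).toNat + (z e).toNat
  ring

/-- Exchanging the last two copies of the kernel does not change any level core. -/
lemma core_swap (K : Config E → Config E → Config E → R) (ℓ : E → Fin 4) :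
    core (fun x y z => K x z y) ℓ = core K ℓ := by
  unfold core
  refine Finset.sum_congr rfl fun x _ => ?_
  rw [Finset.sum_comm]
  refine Finset.sum_congr rfl fun y _ => Finset.sum_congr rfl fun z _ => ?_
  rw [lev_swap]

/-- The level core is additive in the kernel. -/
lemma core_add (K K' : Config E → Config E → Config E → R) (ℓ : E → Fin 4) :
    core (fun x y z => K x y z + K' x y z) ℓ = core K ℓ + core K' ℓ := by
  unfold core
  simp only [← Finset.sum_add_distrib]
  refine Finset.sum_congr rfl fun x _ => Finset.sum_congr rfl fun y _ =>
    Finset.sum_congr rfl fun z _ => ?_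
  split_ifs <;> simp

/-- The level core respects differences of kernels. -/
lemma core_sub (K K' : Config E → Config E → Config E → R) (ℓ : E → Fin 4) :
    core (fun x y z => K x y z - K' x y z) ℓ = core K ℓ - core K' ℓ := by
  unfold core
  simp only [← Finset.sum_sub_distrib]
  refine Finset.sum_congr rfl fun x _ => Finset.sum_congr rfl fun y _ =>
    Finset.sum_congr rfl fun z _ => ?_
  split_ifs <;> simp

/-- Exchanging the last two copies of the kernel does not change the three-copy form. -/
lemma triForm_swap (p : E → R) (K : Config E → Config E → Config E → R) :
    triForm p (fun x y z => K x z y) = triForm p K := by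
  unfold triForm
  refine Finset.sum_congr rfl fun x _ => ?_
  rw [Finset.sum_comm]
  refine Finset.sum_congr rfl fun y _ => Finset.sum_congr rfl fun z _ => ?_
  ring

/-- The three-copy form is additive in the kernel. -/
lemma triForm_add (p : E → R) (K K' : Config E → Config E → Config E → R) :
    triForm p (fun x y z => K x y z + K' x y z) = triForm p K + triForm p K' := by
  unfold triForm
  simp only [← Finset.sum_add_distrib]
  refine Finset.sum_congr rfl fun x _ => Finset.sum_congr rfl fun y _ =>
    Finset.sum_congr rfl fun z _ => ?_
  ring

/-- The three-copy form respects differences of kernels. -/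
lemma triForm_sub (p : E → R) (K K' : Config E → Config E → Config E → R) :
    triForm p (fun x y z => K x y z - K' x y z) = triForm p K - triForm p K' := by
  unfold triForm
  simp only [← Finset.sum_sub_distrib]
  refine Finset.sum_congr rfl fun x _ => Finset.sum_congr rfl fun y _ =>
    Finset.sum_congr rfl fun z _ => ?_
  ring

end Symmetry

/-! ## The pairwise kernels -/

section Kernels

variable {V : Type*} {E : Type*} [Fintype E] [DecidableEq E] {R : Type*} [CommRing R]

open NestedMask

/-- The triple avoidance `1_{Q^m}(x) 1_Q(y) 1_Q(z)` — the masked copy `x` and the plain copies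
`y`, `z` all avoid `l ↔ h`. -/
noncomputable def avoid3 (ends : E → Sym2 V) (m : Finset V) (l h : V) (x y z : Config E) : R :=
  avoidInd ends m l h x * avoidInd ends ∅ l h y * avoidInd ends ∅ l h z

/-- **The mixed disagreement kernel** `1_{QQQ} · D_{AB}`: the masked copy `x` against the plain copy
`y`, `(1[b ∈ C^m_l](x) − 1[b ∈ C_l](y)) (1[o ∈ C^m_l](x) − 1[o ∈ C_l](y))`, weighted by the triple
avoidance (the third copy `z` is a spectator). -/
noncomputable def mixedKernel (ends : E → Sym2 V) (m : Finset V) (l h b o : V)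
    (x y z : Config E) : R :=
  avoid3 ends m l h x y z *
    (memInd ends m l b x - memInd ends ∅ l b y) * (memInd ends m l o x - memInd ends ∅ l o y)

/-- **The plain disagreement kernel** `1_{QQQ} · D_{BC}`: the two plain copies `y`, `z` against each
other, `(1[b ∈ C_l](y) − 1[b ∈ C_l](z)) (1[o ∈ C_l](y) − 1[o ∈ C_l](z))`, weighted by the triple
avoidance (the masked copy `x` is a spectator). -/
noncomputable def plainKernel (ends : E → Sym2 V) (m : Finset V) (l h b o : V)
    (x y z : Config E) : R :=
  avoid3 ends m l h x y z *
    (memInd ends ∅ l b y - memInd ends ∅ l b z) * (memInd ends ∅ l o y - memInd ends ∅ l o z)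

omit [Fintype E] [DecidableEq E] in
/-- The triple avoidance is symmetric in the two plain copies. -/
lemma avoid3_swap (ends : E → Sym2 V) (m : Finset V) (l h : V) (x y z : Config E) :
    avoid3 (R := R) ends m l h x z y = avoid3 ends m l h x y z := by
  simp only [avoid3]
  ring

omit [Fintype E] [DecidableEq E] in
/-- **The pointwise exchange identity**: the 2′CDC kernel plus its copy-exchanged version equals the
mixed kernel plus its copy-exchanged version minus the plain kernel,
`(B_x − B_y)(O_x − O_z) + (B_x − B_z)(O_x − O_y) = (B_x − B_y)(O_x − O_y) + (B_x − B_z)(O_x − O_z) −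
(B_y − B_z)(O_y − O_z)`. -/
lemma cdcKernel_add_swap (ends : E → Sym2 V) (m : Finset V) (l h b o : V) (x y z : Config E) :
    cdcKernel (R := R) ends m l h b o x y z + cdcKernel ends m l h b o x z y =
      mixedKernel ends m l h b o x y z + mixedKernel ends m l h b o x z y -
        plainKernel ends m l h b o x y z := by
  simp only [cdcKernel, mixedKernel, plainKernel, avoid3]
  ring

end Kernels

/-! ## The core identity -/

section Core

variable {V : Type*} {E : Type*} [Fintype E] [DecidableEq E] {R : Type*} [CommRing R]

open NestedMask

/-- **The pairwise-disagreement form of the 2′CDC core** (`proofs/MINE1-J1.md` §30 add. 1 (iii)):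
for every level `ℓ`, `2 · core(cdc) = 2 · core(mixed) − core(plain)`. -/
theorem two_mul_core_cdcKernel (ends : E → Sym2 V) (m : Finset V) (l h b o : V) (ℓ : E → Fin 4) :
    2 * core (cdcKernel (R := R) ends m l h b o) ℓ =
      2 * core (mixedKernel ends m l h b o) ℓ - core (plainKernel ends m l h b o) ℓ := by
  have h1 : 2 * core (cdcKernel (R := R) ends m l h b o) ℓ =
      core (fun x y z => cdcKernel (R := R) ends m l h b o x y z +
        cdcKernel ends m l h b o x z y) ℓ := by
    rw [core_add, core_swap]
    ring
  have h2 : 2 * core (mixedKernel (R := R) ends m l h b o) ℓ -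
      core (plainKernel ends m l h b o) ℓ =
      core (fun x y z => (mixedKernel (R := R) ends m l h b o x y z +
        mixedKernel ends m l h b o x z y) - plainKernel ends m l h b o x y z) ℓ := by
    rw [core_sub, core_add, core_swap]
    ring
  rw [h1, h2]
  congr 1
  funext x y z
  exact cdcKernel_add_swap ends m l h b o x y z

end Core

/-! ## The weighted reading -/

section Weighted

variable {V : Type*} {E : Type*} [Fintype E] [DecidableEq E] {R : Type*} [CommRing R]

open NestedMask

/-- Products of three probabilities as triple sums of indicator products (as in
`triForm_cdcKernel`). -/
lemma prob_mul_prob_mul_prob_eq_sum (p : E → R) (A B C : Set (Config E)) :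
    prob p A * prob p B * prob p C =
      ∑ x : Config E, ∑ y : Config E, ∑ z : Config E, weight p x * weight p y * weight p z *
        (A.indicator 1 x * B.indicator 1 y * C.indicator 1 z) := by
  classical
  simp only [prob_eq_expect_indicator, expect]
  rw [Finset.sum_mul_sum, Finset.sum_mul_sum]
  simp only [Finset.sum_mul]
  refine Finset.sum_congr rfl fun x _ => ?_
  rw [Finset.sum_comm]
  refine Finset.sum_congr rfl fun y _ => Finset.sum_congr rfl fun z _ => ?_
  ring

/-- **The three-copy form of the mixed kernel** is `P(Q)` times the mixed disagreement form
`D(P^m, P) = P^m(Q,B,O) P(Q) − P^m(Q,B) P(Q,O) − P^m(Q,O) P(Q,B) + P^m(Q) P(Q,B,O)`. -/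
theorem triForm_mixedKernel (p : E → R) (ends : E → Sym2 V) (m : Finset V) (l h b o : V) :
    triForm p (mixedKernel ends m l h b o) =
      prob p (Qm ends m l h ∩ mconnEvent ends m l b ∩ mconnEvent ends m l o) *
          prob p (Qm ends ∅ l h) * prob p (Qm ends ∅ l h) -
        prob p (Qm ends m l h ∩ mconnEvent ends m l b) *
          prob p (Qm ends ∅ l h ∩ mconnEvent ends ∅ l o) * prob p (Qm ends ∅ l h) -
        prob p (Qm ends m l h ∩ mconnEvent ends m l o) *
          prob p (Qm ends ∅ l h ∩ mconnEvent ends ∅ l b) * prob p (Qm ends ∅ l h) +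
        prob p (Qm ends m l h) *
          prob p (Qm ends ∅ l h ∩ mconnEvent ends ∅ l b ∩ mconnEvent ends ∅ l o) *
          prob p (Qm ends ∅ l h) := by
  classical
  simp only [prob_mul_prob_mul_prob_eq_sum, triForm, ← Finset.sum_sub_distrib,
    ← Finset.sum_add_distrib]
  refine Finset.sum_congr rfl fun x _ => Finset.sum_congr rfl fun y _ =>
    Finset.sum_congr rfl fun z _ => ?_
  simp only [mixedKernel, avoid3, avoidInd, memInd, Qm, Set.inter_indicator_one, Pi.mul_apply]
  ring

/-- **The three-copy form of the plain kernel** is `P^m(Q)` times the plain disagreement form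
`D(P, P) = 2 (P(Q) P(Q,B,O) − P(Q,B) P(Q,O))`, twice the BHK slack of the plain graph. -/
theorem triForm_plainKernel (p : E → R) (ends : E → Sym2 V) (m : Finset V) (l h b o : V) :
    triForm p (plainKernel ends m l h b o) =
      prob p (Qm ends m l h) * prob p (Qm ends ∅ l h) *
          prob p (Qm ends ∅ l h ∩ mconnEvent ends ∅ l b ∩ mconnEvent ends ∅ l o) -
        prob p (Qm ends m l h) * prob p (Qm ends ∅ l h ∩ mconnEvent ends ∅ l b) *
          prob p (Qm ends ∅ l h ∩ mconnEvent ends ∅ l o) -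
        prob p (Qm ends m l h) * prob p (Qm ends ∅ l h ∩ mconnEvent ends ∅ l o) *
          prob p (Qm ends ∅ l h ∩ mconnEvent ends ∅ l b) +
        prob p (Qm ends m l h) *
          prob p (Qm ends ∅ l h ∩ mconnEvent ends ∅ l b ∩ mconnEvent ends ∅ l o) *
          prob p (Qm ends ∅ l h) := by
  classical
  simp only [prob_mul_prob_mul_prob_eq_sum, triForm, ← Finset.sum_sub_distrib,
    ← Finset.sum_add_distrib]
  refine Finset.sum_congr rfl fun x _ => Finset.sum_congr rfl fun y _ =>
    Finset.sum_congr rfl fun z _ => ?_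
  simp only [plainKernel, avoid3, avoidInd, memInd, Qm, Set.inter_indicator_one, Pi.mul_apply]
  ring

/-- **The weighted exchange identity**: `2 · T = 2 · triForm(mixed) − triForm(plain)`, i.e.
`T = P(Q) · D(P^m, P) − P^m(Q) · K` with `K` the plain BHK slack. -/
theorem two_mul_triForm_cdcKernel (p : E → R) (ends : E → Sym2 V) (m : Finset V) (l h b o : V) :
    2 * triForm p (cdcKernel (R := R) ends m l h b o) =
      2 * triForm p (mixedKernel ends m l h b o) - triForm p (plainKernel ends m l h b o) := by
  have h1 : 2 * triForm p (cdcKernel (R := R) ends m l h b o) =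
      triForm p (fun x y z => cdcKernel (R := R) ends m l h b o x y z +
        cdcKernel ends m l h b o x z y) := by
    rw [triForm_add, triForm_swap]
    ring
  have h2 : 2 * triForm p (mixedKernel (R := R) ends m l h b o) -
      triForm p (plainKernel ends m l h b o) =
      triForm p (fun x y z => (mixedKernel (R := R) ends m l h b o x y z +
        mixedKernel ends m l h b o x z y) - plainKernel ends m l h b o x y z) := by
    rw [triForm_sub, triForm_add, triForm_swap]
    ring
  rw [h1, h2]
  congr 1
  funext x y z
  exact cdcKernel_add_swap ends m l h b o x y z

end Weighted

end ThreeCopy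

end Summit.Ventures.PercRepro2
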